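import Mathlib
import Summits.ValiantsHypothesis.ValiantsHypothesis.Theorems.NewtonUnitEquationsNewtonTauWeakCornerFibre

/-!
# `NewtonTauWeak` (stmt-ValiantsHypothesis-5904), sub-stub `fixedKCoincidence_t2_K3` (siege k15):
# word-model helpers and the RAY LEMMA

Word-model file (objects of `…CornerDefs.lean`: `wt`, `push`, `OnRay`, `sepCoeff`, `box`, `fibreSum`,
`IsOrder`, `Active`) for the siege line `K3R15` towards the registered sub-stub `fixedKCoincidence_t2_K3`
of `stub_binomialNewtonTauCommon` (KPTT arXiv:1308.2286 Conj. 1 at `t = 2`, `K = 3`).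

For a separated product `Π_e V_e(T^{E_e})` (univariate `V_e`, `V_e(0) = 1`, pairwise non-parallel
directions `E_e` of positive weight for a generic weight `w`) the coefficient of the lattice point `z` is the
fibre sum `fibreSum E D 1 0 V V z = Σ_{n ∈ box, push n = z} sepCoeff V n` (coincidences allowed).

* `ray_init` (RAY LEMMA, `K = 2` local structure): the `w`-lightest nonzero point with nonzero fibre sum
  is the lightest ORDER POINT `o_e E_e` of an active factor, and its fibre sum is the order coefficient.
* helpers: `letter_le_wt_push`, `two_letters_le_wt_push`, `wt_natMul`, `wt_sub_eq`, `fibreSum_one_zero`,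
  `active_of_letter`.  The companion file `…K3R15Shifted.lean` proves the shifted-corner rigidity lemma.

No definitions. [folklore]
-/

-- the namespace mandated for this Theorems file repeats the component `ValiantsHypothesis`
set_option linter.dupNamespace false

noncomputable section

open scoped BigOperators Polynomial
open Summit.ValiantsHypothesis.ValiantsHypothesis.Theorems.NewtonTauWeakCorner

namespace Summit.ValiantsHypothesis.ValiantsHypothesis.Theorems.NewtonTauWeakK3R15

/-! ## Small weight facts -/

/-- Weight of a natural multiple. [folklore] -/
theorem wt_natMul (w : Fin 2 → ℝ) (k : ℕ) (z : Fin 2 → ℤ) : wt w ((k : ℤ) • z) = (k : ℝ) * wt w z := by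
  rw [wt_zsmul]; push_cast; ring

/-- Weight of a difference. [folklore] -/
theorem wt_sub_eq (w : Fin 2 → ℝ) (z z' : Fin 2 → ℤ) : wt w (z - z') = wt w z - wt w z' := by
  simp only [wt, Pi.sub_apply, Int.cast_sub]; ring

/-- One letter bounds the weight of a word from below (positive direction weights). [folklore] -/
theorem letter_le_wt_push {s : ℕ} (E : Fin s → Fin 2 → ℤ) (w : Fin 2 → ℝ) (hw : ∀ e, 0 < wt w (E e))
    (n : Fin s → ℕ) (x : Fin s) : (n x : ℝ) * wt w (E x) ≤ wt w (push E n) := by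
  rw [wt_push]
  exact Finset.single_le_sum (f := fun e => (n e : ℝ) * wt w (E e))
    (fun e _ => mul_nonneg (Nat.cast_nonneg _) (hw e).le) (Finset.mem_univ x)

/-- Two distinct letters bound the weight of a word from below. [folklore] -/
theorem two_letters_le_wt_push {s : ℕ} (E : Fin s → Fin 2 → ℤ) (w : Fin 2 → ℝ) (hw : ∀ e, 0 < wt w (E e))
    (n : Fin s → ℕ) {x y : Fin s} (hxy : x ≠ y) :
    (n x : ℝ) * wt w (E x) + (n y : ℝ) * wt w (E y) ≤ wt w (push E n) := by
  rw [wt_push, ← Finset.sum_pair (f := fun e => (n e : ℝ) * wt w (E e)) hxy]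
  exact Finset.sum_le_sum_of_subset_of_nonneg (by intro e _; exact Finset.mem_univ e)
    (fun e _ _ => mul_nonneg (Nat.cast_nonneg _) (hw e).le)

/-- A word all of whose letters other than `x` vanish is a pure power of `x`. [folklore] -/
theorem eq_single_of_forall_ne {s : ℕ} (n : Fin s → ℕ) (x : Fin s) (h : ∀ y, y ≠ x → n y = 0) :
    n = Pi.single x (n x) := by
  funext y
  by_cases hy : y = x
  · subst hy; simp
  · simp [hy, h y hy]

/-- The fibre sum with weights `(1, 0)` is the plain fibre sum of the first separated coefficient. [folklore] -/
theorem fibreSum_one_zero {s D : ℕ} (E : Fin s → Fin 2 → ℤ) (P Q : Fin s → ℂ[X]) (z : Fin 2 → ℤ) :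
    fibreSum E D 1 0 P Q z = ∑ n ∈ (box s D).filter (fun n => push E n = z), sepCoeff P n := by
  unfold fibreSum
  exact Finset.sum_congr rfl fun n _ => by ring

/-- A word contributing to a plain fibre sum. [folklore] -/
theorem exists_word_of_fibreSum_ne_zero {s D : ℕ} (E : Fin s → Fin 2 → ℤ) (P : Fin s → ℂ[X]) {z : Fin 2 → ℤ}
    (hz : fibreSum E D 1 0 P P z ≠ 0) : ∃ n ∈ box s D, push E n = z ∧ sepCoeff P n ≠ 0 := by
  classical
  rw [fibreSum_one_zero] at hz
  obtain ⟨n, hn, hne⟩ := Finset.exists_ne_zero_of_sum_ne_zero hz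
  exact ⟨n, (Finset.mem_filter.mp hn).1, (Finset.mem_filter.mp hn).2, hne⟩

/-- A nonzero letter of a contributing word is an active direction, of order at most the letter. [folklore] -/
theorem active_of_letter {s : ℕ} {P : Fin s → ℂ[X]} {n : Fin s → ℕ} (hP : sepCoeff P n ≠ 0) {x : Fin s}
    (hx : n x ≠ 0) (o : Fin s → ℕ) (ho : ∀ e, Active (P e) → IsOrder (P e) (o e)) :
    Active (P x) ∧ o x ≤ n x := by
  have hc := sepCoeff_ne_zero_apply hP x
  have h1 : 1 ≤ n x := Nat.one_le_iff_ne_zero.mpr hx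
  have hA : Active (P x) := ⟨n x, h1, hc⟩
  exact ⟨hA, (ho x hA).le_of_coeff_ne_zero h1 hc⟩

/-! ## The ray lemma -/

/-- **Ray lemma.** For a separated product with constant terms `1`, the `w`-lightest NONZERO lattice point
with nonzero fibre sum is the lightest order point `o_e E_e` of an active factor; its fibre sum is the order
coefficient, and `o_e ⟨w,E_e⟩` is minimal among all weighted orders. [folklore] -/
theorem ray_init {s D : ℕ} (E : Fin s → Fin 2 → ℤ) (w : Fin 2 → ℝ)
    (hw : ∀ e, 0 < wt w (E e)) (hgen : Function.Injective (wt w))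
    (hE : ∀ e e' : Fin s, ∀ k k' : ℕ, 1 ≤ k → (k : ℤ) • E e = (k' : ℤ) • E e' → e = e')
    (P : Fin s → ℂ[X]) (hP0 : ∀ e, (P e).coeff 0 = 1) (hPD : ∀ e, (P e).natDegree ≤ D)
    (z : Fin 2 → ℤ) (hz0 : z ≠ 0) (hz : fibreSum E D 1 0 P P z ≠ 0)
    (hcanc : ∀ z', z' ≠ 0 → wt w z' < wt w z → fibreSum E D 1 0 P P z' = 0) :
    ∃ e k, IsOrder (P e) k ∧ z = (k : ℤ) • E e ∧
      (∀ e' k', IsOrder (P e') k' → (k : ℝ) * wt w (E e) ≤ (k' : ℝ) * wt w (E e')) ∧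
      fibreSum E D 1 0 P P z = (P e).coeff k := by
  classical
  let o : Fin s → ℕ := fun e => if h : Active (P e) then Classical.choose (exists_isOrder h) else 0
  have ho : ∀ e, Active (P e) → IsOrder (P e) (o e) := by
    intro e h; simp only [o, dif_pos h]; exact Classical.choose_spec (exists_isOrder h)
  -- a contributing word and an active letter
  obtain ⟨n, hnbox, hpush, hPn⟩ := exists_word_of_fibreSum_ne_zero E P hz
  have hn0 : n ≠ 0 := by
    rintro rfl; rw [push_zero] at hpush; exact hz0 hpush.symm
  obtain ⟨x, hx⟩ : ∃ x, n x ≠ 0 := by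
    by_contra h; push Not at h; exact hn0 (funext h)
  obtain ⟨hAx, hox⟩ := active_of_letter hPn hx o ho
  -- the lightest active weighted order
  set A := Finset.univ.filter fun e => Active (P e) with hAdef
  obtain ⟨e₁, he₁, hmin₁⟩ := A.exists_min_image (fun e => (o e : ℝ) * wt w (E e))
    ⟨x, Finset.mem_filter.mpr ⟨Finset.mem_univ x, hAx⟩⟩
  have hA1 : Active (P e₁) := (Finset.mem_filter.mp he₁).2
  have ho1 := ho e₁ hA1
  have hmin : ∀ e, Active (P e) → (o e₁ : ℝ) * wt w (E e₁) ≤ (o e : ℝ) * wt w (E e) :=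
    fun e hAe => hmin₁ e (Finset.mem_filter.mpr ⟨Finset.mem_univ e, hAe⟩)
  set p₁ : Fin 2 → ℤ := (o e₁ : ℤ) • E e₁ with hp₁
  have hwp₁ : wt w p₁ = (o e₁ : ℝ) * wt w (E e₁) := wt_natMul w (o e₁) (E e₁)
  have hp₁pos : 0 < wt w p₁ := by rw [hwp₁]; exact mul_pos (by exact_mod_cast ho1.1) (hw e₁)
  have hp₁0 : p₁ ≠ 0 := by
    intro h; have := congrArg (wt w) h; rw [wt_zero] at this; linarith
  -- every contributing word weighs at least `p₁`, mixed ones strictly more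
  have hword : ∀ n' ∈ box s D, sepCoeff P n' ≠ 0 → ∀ y, n' y ≠ 0 → wt w p₁ ≤ wt w (push E n') ∧
      (2 ≤ (Finset.univ.filter fun e => n' e ≠ 0).card → wt w p₁ < wt w (push E n')) := by
    intro n' hn' hP' y hy
    obtain ⟨hAy, hoy⟩ := active_of_letter hP' hy o ho
    have h1 : (o y : ℝ) * wt w (E y) ≤ (n' y : ℝ) * wt w (E y) :=
      mul_le_mul_of_nonneg_right (by exact_mod_cast hoy) (hw y).le
    have h2 := hmin y hAy
    refine ⟨by rw [hwp₁]; exact (h2.trans h1).trans (letter_le_wt_push E w hw n' y), fun h2c => ?_⟩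
    obtain ⟨a, ha, b, hb, hab⟩ := Finset.one_lt_card.mp (lt_of_lt_of_le one_lt_two h2c)
    have ha' := (Finset.mem_filter.mp ha).2
    have hb' := (Finset.mem_filter.mp hb).2
    -- one of `a, b` differs from `y`; use the letters `y` and that one
    have key : ∀ c, c ≠ y → n' c ≠ 0 → wt w p₁ < wt w (push E n') := by
      intro c hcy hc
      have hcpos : 0 < (n' c : ℝ) * wt w (E c) := mul_pos (by exact_mod_cast Nat.pos_of_ne_zero hc) (hw c)
      have := two_letters_le_wt_push E w hw n' (Ne.symm hcy)
      rw [hwp₁]; linarith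
    by_cases hay : a = y
    · exact key b (fun h => hab (hay.trans h.symm)) hb'
    · exact key a hay ha'
  -- the fibre sum at `p₁` is the order coefficient
  have hFp₁ : fibreSum E D 1 0 P P p₁ = (P e₁).coeff (o e₁) := by
    have := fibreSum_pure E w hw hE 1 0 P P hP0 hP0 e₁ (o e₁) ho1.1 (ho1.le_natDegree.trans (hPD e₁))
      (by
        intro n' hn' h2 hor
        have hP' : sepCoeff P n' ≠ 0 := by rcases hor with h | h <;> exact h
        obtain ⟨a, ha, -⟩ := Finset.one_lt_card.mp (lt_of_lt_of_le one_lt_two h2)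
        exact (hword n' hn' hP' a (Finset.mem_filter.mp ha).2).2 h2)
    rw [this]; ring
  have hFp₁ne : fibreSum E D 1 0 P P p₁ ≠ 0 := by rw [hFp₁]; exact ho1.2.1
  -- compare weights
  have hle : wt w z ≤ wt w p₁ := by
    by_contra hlt; push Not at hlt
    exact hFp₁ne (hcanc p₁ hp₁0 hlt)
  have hge : wt w p₁ ≤ wt w z := by rw [← hpush]; exact (hword n hnbox hPn x hx).1
  have heq : z = p₁ := hgen (le_antisymm hle hge)
  refine ⟨e₁, o e₁, ho1, heq, fun e' k' hk' => ?_, by rw [heq, hFp₁]⟩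
  have hA' : Active (P e') := ⟨k', hk'.1, hk'.2.1⟩
  have := hmin e' hA'
  rwa [(ho e' hA').unique hk'] at this

end Summit.ValiantsHypothesis.ValiantsHypothesis.Theorems.NewtonTauWeakK3R15

end
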